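import Summits.CriticalPhenomena.PercolationContinuityZ3.Theorems.PercNearOneGluingNoHeavyLowerTailCubicThreePointFibreCriterion
import Mathlib.Algebra.BigOperators.Group.Finset.Powerset
import Mathlib.Algebra.Order.BigOperators.Group.Finset
import Mathlib.Tactic.Ring
import Mathlib.Tactic.Linarith
import Mathlib.Tactic.Positivity
import HarnessLib

/-!
# `NoHeavyLowerTail` (stmt-CriticalPhenomena-4575) — the three-copy fibre criterion for the row `H_{q+t} = (q+t)·AG − e₃`

Support file (prover prim-sahi-p2; `--supports stmt-CriticalPhenomena-4575`).  The `H_{q+t}` twin of `…CubicThreePointFibreCriterion` (there: SHK3⁺ `F`):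
`hqtW D p K a b c = H_{q+t}(law)`; `Pol6H` = 6 × polar form of `Hqt` (`…TerminalClosure`); `tripleSumH_eq`: the three independent copies expansion;
`regroupH` by profile with the Bernstein weights `W3` of `…FibreCriterion`; `hqtW_nonneg_of_fibH`: all fibre sums `FibH(A) ≥ 0` ⇒ `H_{q+t}(law) ≥ 0` for ALL weights
(`H_{q+t} ⇒ AG⁺ ⇒ SHK3⁺`; Conjecture B⁺⁺ of run/shared/lean/prim/prim-sahi/prim-sahi-p2/PROOF-E3.md §7 is exactly `∀ A, 0 ≤ FibH A` for every graph; certified for all graphs on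
≤ 6 vertices, kit j072389).  Parts II–IV for `H_{q+t}`: `…FibreHqtTable`.
[cite: Gladkov2024StrongFKG, Cor. 4.2 (AG; the cubic rows above it)]
-/

namespace Summit.CriticalPhenomena.PercolationContinuityZ3.Theorems

namespace TerminalGluing

open Finset SimpleGraph Literature.Probability.Percolation Literature.Probability.Percolation.DecisionTree
open CubicThreePointStep CubicThreePointTerminal


/-! ### The polar form of `F` -/

section Pol

variable {R : Type*} [CommRing R]

/-- Six times the symmetric trilinear (polar) form of the cubic `F`, at three cell vectors. [folklore] -/
def Pol6H (q₁ a₁ b₁ c₁ t₁ q₂ a₂ b₂ c₂ t₂ q₃ a₃ b₃ c₃ t₃ : R) : R :=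
  Hqt (q₁ + q₂ + q₃) (a₁ + a₂ + a₃) (b₁ + b₂ + b₃) (c₁ + c₂ + c₃) (t₁ + t₂ + t₃)
    - Hqt (q₁ + q₂) (a₁ + a₂) (b₁ + b₂) (c₁ + c₂) (t₁ + t₂) - Hqt (q₁ + q₃) (a₁ + a₃) (b₁ + b₃) (c₁ + c₃) (t₁ + t₃)
    - Hqt (q₂ + q₃) (a₂ + a₃) (b₂ + b₃) (c₂ + c₃) (t₂ + t₃)
    + Hqt q₁ a₁ b₁ c₁ t₁ + Hqt q₂ a₂ b₂ c₂ t₂ + Hqt q₃ a₃ b₃ c₃ t₃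

/-- `∂H_{q+t}/∂q`. [folklore] -/
def dHq (q a b c t : R) : R := AG q a b c t + (q + t) * t
/-- `∂H_{q+t}/∂u₁`. [folklore] -/
def dHa (q _a b c t : R) : R := -((q + t) * (b + c)) - b * c
/-- `∂H_{q+t}/∂u₂`. [folklore] -/
def dHb (q a _b c t : R) : R := -((q + t) * (a + c)) - a * c
/-- `∂H_{q+t}/∂u₃`. [folklore] -/
def dHc (q a b _c t : R) : R := -((q + t) * (a + b)) - a * b
/-- `∂H_{q+t}/∂t`. [folklore] -/
def dHt (q a b c t : R) : R := AG q a b c t + (q + t) * q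

/-- `Pol6H` is linear in its first slot, with coefficients the polarized partial derivatives. [folklore] -/
theorem Pol6H_slot1 (q₁ a₁ b₁ c₁ t₁ q₂ a₂ b₂ c₂ t₂ q₃ a₃ b₃ c₃ t₃ : R) :
    Pol6H q₁ a₁ b₁ c₁ t₁ q₂ a₂ b₂ c₂ t₂ q₃ a₃ b₃ c₃ t₃ =
      q₁ * (dHq (q₂ + q₃) (a₂ + a₃) (b₂ + b₃) (c₂ + c₃) (t₂ + t₃) - dHq q₂ a₂ b₂ c₂ t₂ - dHq q₃ a₃ b₃ c₃ t₃)
      + a₁ * (dHa (q₂ + q₃) (a₂ + a₃) (b₂ + b₃) (c₂ + c₃) (t₂ + t₃) - dHa q₂ a₂ b₂ c₂ t₂ - dHa q₃ a₃ b₃ c₃ t₃)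
      + b₁ * (dHb (q₂ + q₃) (a₂ + a₃) (b₂ + b₃) (c₂ + c₃) (t₂ + t₃) - dHb q₂ a₂ b₂ c₂ t₂ - dHb q₃ a₃ b₃ c₃ t₃)
      + c₁ * (dHc (q₂ + q₃) (a₂ + a₃) (b₂ + b₃) (c₂ + c₃) (t₂ + t₃) - dHc q₂ a₂ b₂ c₂ t₂ - dHc q₃ a₃ b₃ c₃ t₃)
      + t₁ * (dHt (q₂ + q₃) (a₂ + a₃) (b₂ + b₃) (c₂ + c₃) (t₂ + t₃) - dHt q₂ a₂ b₂ c₂ t₂ - dHt q₃ a₃ b₃ c₃ t₃) := by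
  simp only [Pol6H, Hqt, dHq, dHa, dHb, dHc, dHt, AG]; ring

/-- `Pol6H` is symmetric under exchanging slots 1 and 2. [folklore] -/
theorem Pol6H_swap12 (q₁ a₁ b₁ c₁ t₁ q₂ a₂ b₂ c₂ t₂ q₃ a₃ b₃ c₃ t₃ : R) :
    Pol6H q₁ a₁ b₁ c₁ t₁ q₂ a₂ b₂ c₂ t₂ q₃ a₃ b₃ c₃ t₃ = Pol6H q₂ a₂ b₂ c₂ t₂ q₁ a₁ b₁ c₁ t₁ q₃ a₃ b₃ c₃ t₃ := by
  simp only [Pol6H, Hqt]; ring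

/-- `Pol6H` is symmetric under exchanging slots 1 and 3. [folklore] -/
theorem Pol6H_swap13 (q₁ a₁ b₁ c₁ t₁ q₂ a₂ b₂ c₂ t₂ q₃ a₃ b₃ c₃ t₃ : R) :
    Pol6H q₁ a₁ b₁ c₁ t₁ q₂ a₂ b₂ c₂ t₂ q₃ a₃ b₃ c₃ t₃ = Pol6H q₃ a₃ b₃ c₃ t₃ q₂ a₂ b₂ c₂ t₂ q₁ a₁ b₁ c₁ t₁ := by
  simp only [Pol6H, Hqt]; ring

/-- On the diagonal `Pol6H(x,x,x) = F(3x) − 3F(2x) + 3F(x) = 6F(x)` (homogeneity). [folklore] -/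
theorem Pol6H_diag (q a b c t : R) : Pol6H q a b c t q a b c t q a b c t = 6 * Hqt q a b c t := by
  simp only [Pol6H, Hqt]; ring

end Pol

/-! ### Summing a weighted family through one slot -/

section Linear

variable {α : Type*}

/-- `Pol6H` commutes with weighted sums in slot 1. [folklore] -/
theorem sum_Pol6H_slot1 (P : Finset α) (w f₁ f₂ f₃ f₄ f₅ : α → ℝ) (q₂ a₂ b₂ c₂ t₂ q₃ a₃ b₃ c₃ t₃ : ℝ) :
    ∑ x ∈ P, w x * Pol6H (f₁ x) (f₂ x) (f₃ x) (f₄ x) (f₅ x) q₂ a₂ b₂ c₂ t₂ q₃ a₃ b₃ c₃ t₃ =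
      Pol6H (∑ x ∈ P, w x * f₁ x) (∑ x ∈ P, w x * f₂ x) (∑ x ∈ P, w x * f₃ x) (∑ x ∈ P, w x * f₄ x)
        (∑ x ∈ P, w x * f₅ x) q₂ a₂ b₂ c₂ t₂ q₃ a₃ b₃ c₃ t₃ := by
  rw [Finset.sum_congr rfl (fun x _ => by rw [Pol6H_slot1])]
  conv_rhs => rw [Pol6H_slot1]
  exact sum_linear5 P w f₁ f₂ f₃ f₄ f₅ _ _ _ _ _

/-- `Pol6H` commutes with weighted sums in slot 2. [folklore] -/
theorem sum_Pol6H_slot2 (P : Finset α) (w f₁ f₂ f₃ f₄ f₅ : α → ℝ) (q₁ a₁ b₁ c₁ t₁ q₃ a₃ b₃ c₃ t₃ : ℝ) :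
    ∑ x ∈ P, w x * Pol6H q₁ a₁ b₁ c₁ t₁ (f₁ x) (f₂ x) (f₃ x) (f₄ x) (f₅ x) q₃ a₃ b₃ c₃ t₃ =
      Pol6H q₁ a₁ b₁ c₁ t₁ (∑ x ∈ P, w x * f₁ x) (∑ x ∈ P, w x * f₂ x) (∑ x ∈ P, w x * f₃ x) (∑ x ∈ P, w x * f₄ x)
        (∑ x ∈ P, w x * f₅ x) q₃ a₃ b₃ c₃ t₃ := by
  rw [Finset.sum_congr rfl (fun x _ => by rw [Pol6H_swap12])]
  conv_rhs => rw [Pol6H_swap12]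
  exact sum_Pol6H_slot1 P w f₁ f₂ f₃ f₄ f₅ _ _ _ _ _ _ _ _ _ _

/-- `Pol6H` commutes with weighted sums in slot 3. [folklore] -/
theorem sum_Pol6H_slot3 (P : Finset α) (w f₁ f₂ f₃ f₄ f₅ : α → ℝ) (q₁ a₁ b₁ c₁ t₁ q₂ a₂ b₂ c₂ t₂ : ℝ) :
    ∑ x ∈ P, w x * Pol6H q₁ a₁ b₁ c₁ t₁ q₂ a₂ b₂ c₂ t₂ (f₁ x) (f₂ x) (f₃ x) (f₄ x) (f₅ x) =
      Pol6H q₁ a₁ b₁ c₁ t₁ q₂ a₂ b₂ c₂ t₂ (∑ x ∈ P, w x * f₁ x) (∑ x ∈ P, w x * f₂ x) (∑ x ∈ P, w x * f₃ x)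
        (∑ x ∈ P, w x * f₄ x) (∑ x ∈ P, w x * f₅ x) := by
  rw [Finset.sum_congr rfl (fun x _ => by rw [Pol6H_swap13])]
  conv_rhs => rw [Pol6H_swap13]
  exact sum_Pol6H_slot1 P w f₁ f₂ f₃ f₄ f₅ _ _ _ _ _ _ _ _ _ _

end Linear

variable {V : Type*} [DecidableEq V]

/-! ### The triple-sum (three independent copies) expansion of `6·shk3W` -/

section Triple

variable (D : Finset (Sym2 V)) (p : Sym2 V → ℝ) (K : Finset (Sym2 V)) (a b c : V)

/-- `H_{q+t}` evaluated on the weighted three-point law of `(a,b,c)` with forced edges `K`. [folklore] -/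
noncomputable def hqtW : ℝ :=
  Hqt (PrW D p (evQ K a b c)) (PrW D p (evU₁ K a b c)) (PrW D p (evU₂ K a b c)) (PrW D p (evU₃ K a b c)) (PrW D p (evT K a b c))

/-- `Pol6H` at the cell indicator vectors of three configurations. [folklore] -/
noncomputable def polIndH (S₁ S₂ S₃ : Finset (Sym2 V)) : ℝ :=
  Pol6H (ind (evQ K a b c) S₁) (ind (evU₁ K a b c) S₁) (ind (evU₂ K a b c) S₁) (ind (evU₃ K a b c) S₁) (ind (evT K a b c) S₁)
    (ind (evQ K a b c) S₂) (ind (evU₁ K a b c) S₂) (ind (evU₂ K a b c) S₂) (ind (evU₃ K a b c) S₂) (ind (evT K a b c) S₂)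
    (ind (evQ K a b c) S₃) (ind (evU₁ K a b c) S₃) (ind (evU₂ K a b c) S₃) (ind (evU₃ K a b c) S₃) (ind (evT K a b c) S₃)

/-- **Three-copy expansion**: `Σ_{S₁,S₂,S₃ ⊆ D} w(S₁)w(S₂)w(S₃)·Pol6H(δS₁,δS₂,δS₃) = 6·shk3W` (trilinearity + homogeneity of `F`). [folklore] -/
theorem tripleSumH_eq :
    ∑ S₁ ∈ D.powerset, ∑ S₂ ∈ D.powerset, ∑ S₃ ∈ D.powerset,
        wtW D p S₁ * wtW D p S₂ * wtW D p S₃ * polIndH K a b c S₁ S₂ S₃ = 6 * hqtW D p K a b c := by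
  have h3 : ∀ S₁ S₂ : Finset (Sym2 V), ∑ S₃ ∈ D.powerset, wtW D p S₁ * wtW D p S₂ * wtW D p S₃ * polIndH K a b c S₁ S₂ S₃ =
      wtW D p S₁ * wtW D p S₂ * Pol6H
        (ind (evQ K a b c) S₁) (ind (evU₁ K a b c) S₁) (ind (evU₂ K a b c) S₁) (ind (evU₃ K a b c) S₁) (ind (evT K a b c) S₁)
        (ind (evQ K a b c) S₂) (ind (evU₁ K a b c) S₂) (ind (evU₂ K a b c) S₂) (ind (evU₃ K a b c) S₂) (ind (evT K a b c) S₂)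
        (PrW D p (evQ K a b c)) (PrW D p (evU₁ K a b c)) (PrW D p (evU₂ K a b c)) (PrW D p (evU₃ K a b c))
        (PrW D p (evT K a b c)) := by
    intro S₁ S₂
    have hre : ∀ S₃ ∈ D.powerset, wtW D p S₁ * wtW D p S₂ * wtW D p S₃ * polIndH K a b c S₁ S₂ S₃ =
        wtW D p S₁ * wtW D p S₂ * (wtW D p S₃ * polIndH K a b c S₁ S₂ S₃) := fun S₃ _ => by ring
    rw [Finset.sum_congr rfl hre, ← Finset.mul_sum]
    simp only [polIndH]
    rw [sum_Pol6H_slot3, ← PrW_eq_sum_ind, ← PrW_eq_sum_ind, ← PrW_eq_sum_ind, ← PrW_eq_sum_ind, ← PrW_eq_sum_ind]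
  have h2 : ∀ S₁ : Finset (Sym2 V), ∑ S₂ ∈ D.powerset, ∑ S₃ ∈ D.powerset,
      wtW D p S₁ * wtW D p S₂ * wtW D p S₃ * polIndH K a b c S₁ S₂ S₃ =
      wtW D p S₁ * Pol6H
        (ind (evQ K a b c) S₁) (ind (evU₁ K a b c) S₁) (ind (evU₂ K a b c) S₁) (ind (evU₃ K a b c) S₁) (ind (evT K a b c) S₁)
        (PrW D p (evQ K a b c)) (PrW D p (evU₁ K a b c)) (PrW D p (evU₂ K a b c)) (PrW D p (evU₃ K a b c))
        (PrW D p (evT K a b c))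
        (PrW D p (evQ K a b c)) (PrW D p (evU₁ K a b c)) (PrW D p (evU₂ K a b c)) (PrW D p (evU₃ K a b c))
        (PrW D p (evT K a b c)) := by
    intro S₁
    rw [Finset.sum_congr rfl (fun S₂ _ => h3 S₁ S₂)]
    have hre : ∀ S₂ ∈ D.powerset, wtW D p S₁ * wtW D p S₂ * Pol6H
        (ind (evQ K a b c) S₁) (ind (evU₁ K a b c) S₁) (ind (evU₂ K a b c) S₁) (ind (evU₃ K a b c) S₁) (ind (evT K a b c) S₁)
        (ind (evQ K a b c) S₂) (ind (evU₁ K a b c) S₂) (ind (evU₂ K a b c) S₂) (ind (evU₃ K a b c) S₂) (ind (evT K a b c) S₂)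
        (PrW D p (evQ K a b c)) (PrW D p (evU₁ K a b c)) (PrW D p (evU₂ K a b c)) (PrW D p (evU₃ K a b c))
        (PrW D p (evT K a b c)) =
        wtW D p S₁ * (wtW D p S₂ * Pol6H
        (ind (evQ K a b c) S₁) (ind (evU₁ K a b c) S₁) (ind (evU₂ K a b c) S₁) (ind (evU₃ K a b c) S₁) (ind (evT K a b c) S₁)
        (ind (evQ K a b c) S₂) (ind (evU₁ K a b c) S₂) (ind (evU₂ K a b c) S₂) (ind (evU₃ K a b c) S₂) (ind (evT K a b c) S₂)
        (PrW D p (evQ K a b c)) (PrW D p (evU₁ K a b c)) (PrW D p (evU₂ K a b c)) (PrW D p (evU₃ K a b c))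
        (PrW D p (evT K a b c))) := fun S₂ _ => by ring
    rw [Finset.sum_congr rfl hre, ← Finset.mul_sum, sum_Pol6H_slot2, ← PrW_eq_sum_ind, ← PrW_eq_sum_ind, ← PrW_eq_sum_ind,
      ← PrW_eq_sum_ind, ← PrW_eq_sum_ind]
  rw [Finset.sum_congr rfl (fun S₁ _ => h2 S₁), sum_Pol6H_slot1, ← PrW_eq_sum_ind, ← PrW_eq_sum_ind, ← PrW_eq_sum_ind,
    ← PrW_eq_sum_ind, ← PrW_eq_sum_ind, Pol6H_diag, hqtW]

end Triple

/-! ### Regrouping by the profile of the triple -/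

section Regroup

variable (D : Finset (Sym2 V)) (p : Sym2 V → ℝ) (K : Finset (Sym2 V)) (a b c : V)

/-- The fibre sum of a profile `A`: `Σ_{(S₁,S₂,S₃) : data3 = A} Pol6H(δS₁,δS₂,δS₃)` (`3^m` times the tensor-Bernstein coefficient of `6·shk3W`). [folklore] -/
noncomputable def FibH (A : Finset (Sym2 V) × Finset (Sym2 V) × Finset (Sym2 V)) : ℝ :=
  ∑ S₁ ∈ D.powerset, ∑ S₂ ∈ D.powerset, ∑ S₃ ∈ D.powerset, if data3 S₁ S₂ S₃ = A then polIndH K a b c S₁ S₂ S₃ else 0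

/-- **Regrouping by profile**: `Σ_A W3(A)·Fib(A) = Σ_{S₁,S₂,S₃} w w w · Pol6H`. [folklore] -/
theorem regroupH :
    ∑ A ∈ D.powerset ×ˢ (D.powerset ×ˢ D.powerset), W3 D p A * FibH D K a b c A =
      ∑ S₁ ∈ D.powerset, ∑ S₂ ∈ D.powerset, ∑ S₃ ∈ D.powerset,
        wtW D p S₁ * wtW D p S₂ * wtW D p S₃ * polIndH K a b c S₁ S₂ S₃ := by
  simp only [FibH, Finset.mul_sum]
  rw [Finset.sum_comm]
  refine Finset.sum_congr rfl fun S₁ hS₁ => ?_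
  rw [Finset.sum_comm]
  refine Finset.sum_congr rfl fun S₂ hS₂ => ?_
  rw [Finset.sum_comm]
  refine Finset.sum_congr rfl fun S₃ hS₃ => ?_
  simp only [mul_ite, mul_zero]
  have hflip : ∀ A ∈ D.powerset ×ˢ (D.powerset ×ˢ D.powerset),
      (if data3 S₁ S₂ S₃ = A then W3 D p A * polIndH K a b c S₁ S₂ S₃ else 0) =
      (if data3 S₁ S₂ S₃ = A then W3 D p (data3 S₁ S₂ S₃) * polIndH K a b c S₁ S₂ S₃ else 0) := by
    intro A _; split_ifs with h
    · rw [h]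
    · rfl
  rw [Finset.sum_congr rfl hflip, Finset.sum_ite_eq]
  have hmem : data3 S₁ S₂ S₃ ∈ D.powerset ×ˢ (D.powerset ×ˢ D.powerset) := by
    rw [Finset.mem_powerset] at hS₁ hS₂ hS₃
    dsimp only [data3]
    simp only [Finset.mem_product, Finset.mem_powerset]
    refine ⟨?_, ?_, ?_⟩
    · exact Finset.union_subset (Finset.union_subset hS₁ hS₂) hS₃
    · exact Finset.union_subset (Finset.union_subset ((Finset.inter_subset_left).trans hS₁)
        ((Finset.inter_subset_left).trans hS₁)) ((Finset.inter_subset_left).trans hS₂)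
    · exact (Finset.inter_subset_left.trans Finset.inter_subset_left).trans hS₁
  rw [if_pos hmem, wt_triple]

/-- **Fibre criterion.**  If every fibre sum is nonnegative (a weight-free statement about the graph `(D, K; a, b, c)`), then
`SHK3⁺ = F(law) ≥ 0` for ALL edge weights in `[0,1]`. [folklore] -/
theorem hqtW_nonneg_of_fibH (hp0 : ∀ e, 0 ≤ p e) (hp1 : ∀ e, p e ≤ 1)
    (hFib : ∀ A ∈ D.powerset ×ˢ (D.powerset ×ˢ D.powerset), 0 ≤ FibH D K a b c A) :
    0 ≤ hqtW D p K a b c := by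
  have h6 : 6 * hqtW D p K a b c = ∑ A ∈ D.powerset ×ˢ (D.powerset ×ˢ D.powerset), W3 D p A * FibH D K a b c A := by
    rw [regroupH, tripleSumH_eq]
  have hs : 0 ≤ ∑ A ∈ D.powerset ×ˢ (D.powerset ×ˢ D.powerset), W3 D p A * FibH D K a b c A :=
    Finset.sum_nonneg fun A hA => mul_nonneg (W3_nonneg D p hp0 hp1 A) (hFib A hA)
  linarith

end Regroup

end TerminalGluing

end Summit.CriticalPhenomena.PercolationContinuityZ3.Theorems
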